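import Summits.BirchSwinnertonDyer.BirchSwinnertonDyer.Theorems.GenusKolyvaginAtTwoEquivariantKolyvaginExactAtTwoSelmerDescentLocalInertia
import Summits.BirchSwinnertonDyer.BirchSwinnertonDyer.Theorems.GenusKolyvaginAtTwoEquivariantKolyvaginExactAtTwoSelmerDescentQuadratic
import Summits.BirchSwinnertonDyer.BirchSwinnertonDyer.Theorems.GenusKolyvaginAtTwoEquivariantKolyvaginExactAtTwoTwistLocalConditions
import HarnessLib

/-!
# Route `GenusKolyvaginAtTwo`, LINE 6, KEY crux Q3 (inner statement of stmt-BirchSwinnertonDyer-22137):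
# the Selmer local condition descends `K → ℚ` at a GOOD place UNRAMIFIED in `K`, at ANY level — McCallum's
# Lemma 4.3 over `ℚ` at `v = 2` INERT in the Heegner field (`d_K ≡ 5 mod 8`), for the member `E`

Helper (seat `bsd-line-gk2-p3` g13; `--supports` the crux, closes nothing). Sequel to `…SelmerDescentLocalInertia`
(§1 the transfer in `H¹(F_v, E)` at good reduction along an extension fixed by the local inertia group, Milne ADT
I Prop. 3.8; §3 `I_𝔐 ≤ Γ_{\tilde L_w}` for `L = F(√c)`, `c ≡ 1 (mod 4)`, `v ∤ c`). Here the Selmer-level statements: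

* §4 `mem_selmerLocalKer_of_resTorsion_mem_of_sq_eq_one_add_four_mul` — **`res x ∈ selmerLocalKer_w(E_L) ⟹
  x ∈ selmerLocalKer_v(E)` at a good place `v ∤ c` (`L = F(√c)`, `c = 1 + 4d ∈ 𝓞 F`), for EVERY `n`** — also
  `v ∣ n`, also `v ∣ 2` (unlike `…SelmerDescentUnramified/Quadratic`, which need `v ∤ n`).
* §5 over `ℚ` (`K = ℚ(θ)`, `θ² = c = 1 + 4d ∈ ℤ`): `mem_selmerLocalKer_of_resTorsion_mem_quadratic_of_one_add_four_mul`,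
  `mem_selmerLocalKer_of_K_of_one_add_four_mul` (member `E`, from the `K`-level condition of `c_K = res u` at the
  places above `v`), `mem_selmerLocalKer_twin_of_K_of_one_add_four_mul` (member `E^{(c')}` through `hPsiKT`; needs
  the twist's good reduction at `v`).

Reading for the crux (pair descent at `2` over `ℚ`, `n = 2^M`, `d_K` odd hence `d_K ≡ 1 mod 4`,
`TwinGrossPrimes.discr_emod_four_eq_one_and_squarefree_of_odd`): Lemma 4.3 over `ℚ` for the member `E` at `v = 2`
follows from Lemma 4.3 over `K` whenever `E` is good at `2` — i.e. on the whole habitat off `2 ∣ N`, and `2 ∣ N` is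
the split case (`…SelmerDescentSplit`). Together with `…SelmerDescentTwoTorsion` (odd `v ∣ d_K`, both members, DEF-free
in arithmetic form) the residual ℚ-hypotheses of `VisiblePairAtTwo.Input.loc_c₁_fin` reduce to: the `K`-statement,
`#E(ℚ_v)[2] = 1` at `v ∣ d_K`, and "every bad place and every place where `d_K` is a local square splits"
(Heegner hypothesis + Hensel); for `loc_c₂_fin` the twin at `v = 2` inert additionally needs `E^{(d_K)}` good at `2`.
THEOREMS ONLY (no definition, no named fact, no `sorry`, standard axioms). BSD is not proved by any of this.

References: [McCallumLMS1991] §4 Lemma 4.3; [MilneADT2006] I Prop. 3.8; [NeukirchANT1999] Ch. V Lemma (3.4);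
[Kolyvagin1989Izv] §3 (the pair `(E, E^D)`, criterion `B_2(E, D)`); [GrossLMS1991] Prop. 6.2 (1);
[SilvermanAEC2009] X.5 Cor. 5.4.
-/

set_option autoImplicit false
set_option linter.dupNamespace false -- tree convention: `Summit.BirchSwinnertonDyer.BirchSwinnertonDyer.Theorems` (summit = sub-problem)

noncomputable section

open scoped Classical

universe u

namespace Summit.BirchSwinnertonDyer.BirchSwinnertonDyer.Theorems.GenusExact.SelmerDescent

open WeierstrassCurve NumberField IsDedekindDomain Field
open Literature.NumberTheory.EllipticCurves Literature.NumberTheory.GaloisRepresentations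
open Summit.BirchSwinnertonDyer.BirchSwinnertonDyer.Theorems.GenusExact.EigenClassesFinite

/-! ## §4 The Selmer condition descends at a good place unramified in `F(√c)` — any level `n` -/

section Descent

variable {F : Type u} [Field F] [NumberField F] (W : WeierstrassCurve F) [W.IsElliptic]
variable (L : Type u) [Field L] [NumberField L] [Algebra F L]
variable (v : HeightOneSpectrum (𝓞 F)) (w : HeightOneSpectrum (𝓞 L)) [w.asIdeal.LiesOver v.asIdeal]

/-- **McCallum's Lemma 4.3 transported from `L = F(√c)` to `F` at a good place `v ∤ c`, `c ≡ 1 (mod 4)`, for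
ANY level `n` — also `v ∣ n`, also `v ∣ 2`.** `L = F[θ]`, `θ² = c = 1 + 4d ∈ 𝓞 F`, `E = W/F` elliptic with good
reduction at `v ∤ c`, `w ∣ v`, `x ∈ H¹(F, E[n])`: if `res x` satisfies the Selmer condition of `E_L` at `w` then `x`
satisfies the Selmer condition of `E` at `v`. (The image of `x` in `H¹(F, E)` dies over `L_w`; `I_𝔐` fixes
`\tilde L_w` (§3); so it dies over `F_v` (§1).) Unlike `…SelmerDescentUnramified/Quadratic` (good `v ∤ n`, via
unramified classes of `H¹(F, E[n])`) this works at the places dividing `n`: for the pair descent of LINE 6 at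
`v = 2 ∤ d_K` (`n = 2^M`, `d_K ≡ 1 mod 4`; the INERT case `d_K ≡ 5 mod 8` is the one not already covered by
`…SelmerDescentSplit`). [cite: McCallumLMS1991, §4 Lemma 4.3] [cite: MilneADT2006, I Prop. 3.8]
[cite: NeukirchANT1999, Ch. V Lemma (3.4)] -/
theorem mem_selmerLocalKer_of_resTorsion_mem_of_sq_eq_one_add_four_mul {θ : L}
    (hθ : Algebra.adjoin F {θ} = ⊤) {c d : 𝓞 F} (hcd : c = 1 + 4 * d) (hc : θ ^ 2 = algebraMap (𝓞 F) L c)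
    (n : ℤ) (hgood : W.HasGoodReductionAt v) (hcv : c ∉ v.asIdeal) {x : galH1Torsion W n}
    (hx : resTorsion W L n x ∈ selmerLocalKer (W.baseChange L) (w.adicCompletion L) n) :
    x ∈ selmerLocalKer W (v.adicCompletion F) n := by
  letI : Algebra (v.adicCompletion F) (w.adicCompletion L) := (adicCompletionMap (K := F) L v w).toAlgebra
  obtain ⟨hfin, -⟩ := finrank_adicCompletion_le_of_liesOver L v w
  haveI : FiniteDimensional (v.adicCompletion F) (w.adicCompletion L) := hfin
  haveI : IsScalarTower F (v.adicCompletion F) (w.adicCompletion L) :=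
    IsScalarTower.of_algebraMap_eq fun x ↦ (adicCompletionMap_coe (K := F) L v w x).symm
  rw [mem_selmerLocalKer_iff_torsionH1ToH1_mem]
  rw [mem_selmerLocalKer_iff_torsionH1ToH1_mem, torsionH1ToH1_resTorsion] at hx
  have hx' : torsionH1ToH1 W n x ∈ W.localRestrictionKer (w.adicCompletion L) :=
    (mem_localRestrictionKer_iff_resBaseChange_mem W _).mpr hx
  obtain ⟨𝔐, h𝔐⟩ := v.localPrimesAbove_nonempty
  exact mem_localRestrictionKer_of_tower_of_inertia_le_finGalSubgroup W v (w.adicCompletion L) hgood h𝔐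
    (localInertia_le_finGalSubgroup_of_sq_eq_one_add_four_mul L v w hθ hcd hc hcv h𝔐) hx'

end Descent

/-! ## §5 Over `ℚ` with `K = ℚ(√c)`, `c ≡ 1 (mod 4)`: member `E` and member `E^{(c')}` -/

section Rat

variable {K : Type} [Field K] [NumberField K] (W : WeierstrassCurve ℚ) [W.IsElliptic]

/-- **Lemma 4.3 from `K = ℚ(√c)` to `ℚ` at a good place `v ∤ c`, `c ≡ 1 (mod 4)`, any level** (`K = ℚ(θ)` quadratic,
`θ ∉ ℚ`, `θ² = c = 1 + 4d ∈ ℤ`; e.g. `v = 2` inert or split in `K`): `res x ∈ selmerLocalKer_w(E_K) ⟹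
x ∈ selmerLocalKer_v(E)`. [cite: McCallumLMS1991, §4 Lemma 4.3] [cite: MilneADT2006, I Prop. 3.8] -/
theorem mem_selmerLocalKer_of_resTorsion_mem_quadratic_of_one_add_four_mul (h2 : Module.finrank ℚ K = 2)
    {θ : K} (hθ : θ ∉ (algebraMap ℚ K).range) {c d : ℤ} (hcd : c = 1 + 4 * d) (hc : θ ^ 2 = algebraMap ℚ K c)
    (n : ℤ) (v : HeightOneSpectrum (𝓞 ℚ)) (w : HeightOneSpectrum (𝓞 K)) [w.asIdeal.LiesOver v.asIdeal]
    (hgood : W.HasGoodReductionAt v) (hcv : ((c : ℤ) : 𝓞 ℚ) ∉ v.asIdeal) {x : galH1Torsion W n}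
    (hx : resTorsion W K n x ∈ selmerLocalKer (W.baseChange K) (w.adicCompletion K) n) :
    x ∈ selmerLocalKer W (v.adicCompletion ℚ) n := by
  have hcd' : ((c : ℤ) : 𝓞 ℚ) = 1 + 4 * ((d : ℤ) : 𝓞 ℚ) := by rw [hcd]; push_cast; ring
  have hc' : θ ^ 2 = algebraMap (𝓞 ℚ) K ((c : ℤ) : 𝓞 ℚ) := by
    rw [hc, IsScalarTower.algebraMap_apply (𝓞 ℚ) ℚ K, map_intCast, map_intCast, map_intCast]
  exact mem_selmerLocalKer_of_resTorsion_mem_of_sq_eq_one_add_four_mul W K v w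
    (adjoin_simple_eq_top_of_finrank_eq_two h2 hθ) hcd' hc' n hgood hcv hx

/-- **Member `E`, one good place `v ∤ c` with `c ≡ 1 (mod 4)`, any level** (`K = ℚ(√c)`): the ℚ-level Selmer
condition of `u` at `v` from the `K`-level condition of `c_K = res u` at the places above `v`. For the pair descent
of LINE 6: Lemma 4.3 over `ℚ` for `E` at `v = 2` (`2 ∤ N`, `d_K ≡ 1 mod 4`) from Lemma 4.3 over `K`.
[cite: McCallumLMS1991, §4 Lemma 4.3] [cite: Kolyvagin1989Izv, §3] -/
theorem mem_selmerLocalKer_of_K_of_one_add_four_mul (h2 : Module.finrank ℚ K = 2) {θ : K}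
    (hθ : θ ∉ (algebraMap ℚ K).range) {c d : ℤ} (hcd : c = 1 + 4 * d) (hc : θ ^ 2 = algebraMap ℚ K c)
    (n : ℤ) {u : galH1Torsion W n} {cK : galH1Torsion (W.baseChange K) n} (hu : resTorsion W K n u = cK)
    (v : HeightOneSpectrum (𝓞 ℚ)) (hgood : W.HasGoodReductionAt v) (hcv : ((c : ℤ) : 𝓞 ℚ) ∉ v.asIdeal)
    (hK : ∀ (w : HeightOneSpectrum (𝓞 K)) [w.asIdeal.LiesOver v.asIdeal],
      cK ∈ selmerLocalKer (W.baseChange K) (w.adicCompletion K) n) :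
    u ∈ selmerLocalKer W (v.adicCompletion ℚ) n := by
  obtain ⟨w, hw⟩ := exists_liesOver K v
  exact mem_selmerLocalKer_of_resTorsion_mem_quadratic_of_one_add_four_mul W h2 hθ hcd hc n v w hgood hcv
    (hu ▸ hK w)

omit [W.IsElliptic] in
/-- **Member `E^{(c')}`, one good place (for the twist) `v ∤ c` with `c ≡ 1 (mod 4)`, any level** (`K = ℚ(θ₀)`,
`θ₀² = c`; the twist read through `hPsiKT` for `θ² = c'`): the ℚ-level Selmer condition of `y` at `v` from the
`K`-level condition of `c_K = hPsiKT (res y)` at the places above `v`. (For LINE 6 at `v = 2`: needs the twin's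
good reduction at `2`.) [cite: McCallumLMS1991, §4 Lemma 4.3] [cite: SilvermanAEC2009, X.5 Cor. 5.4] -/
theorem mem_selmerLocalKer_twin_of_K_of_one_add_four_mul (h2 : Module.finrank ℚ K = 2) {θ₀ : K}
    (hθ₀ : θ₀ ∉ (algebraMap ℚ K).range) {c d : ℤ} (hcd : c = 1 + 4 * d) (hc₀ : θ₀ ^ 2 = algebraMap ℚ K c)
    {θ : K} {c' : ℚ} (hθ : θ ∉ Set.range (algebraMap ℚ K)) (hc : θ ^ 2 = algebraMap ℚ K c')
    [(W.quadraticTwist c').IsElliptic] (n : ℤ) {y : galH1Torsion (W.quadraticTwist c') n}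
    {cK : galH1Torsion (W.baseChange K) n}
    (hy : hPsiKT W K hθ hc n (resTorsion (W.quadraticTwist c') K n y) = cK) (v : HeightOneSpectrum (𝓞 ℚ))
    (hgood' : (W.quadraticTwist c').HasGoodReductionAt v) (hcv : ((c : ℤ) : 𝓞 ℚ) ∉ v.asIdeal)
    (hK : ∀ (w : HeightOneSpectrum (𝓞 K)) [w.asIdeal.LiesOver v.asIdeal],
      cK ∈ selmerLocalKer (W.baseChange K) (w.adicCompletion K) n) :
    y ∈ selmerLocalKer (W.quadraticTwist c') (v.adicCompletion ℚ) n := by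
  obtain ⟨w, hw⟩ := exists_liesOver K v
  have hx : resTorsion (W.quadraticTwist c') K n y ∈
      selmerLocalKer ((W.quadraticTwist c').baseChange K) (w.adicCompletion K) n := by
    rw [mem_selmerLocalKer_iff_hPsiKT_mem W K hθ hc n (w.adicCompletion K), hy]
    exact hK w
  exact mem_selmerLocalKer_of_resTorsion_mem_quadratic_of_one_add_four_mul (W.quadraticTwist c') h2 hθ₀ hcd hc₀
    n v w hgood' hcv hx

end Rat

end Summit.BirchSwinnertonDyer.BirchSwinnertonDyer.Theorems.GenusExact.SelmerDescent

end
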